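import Summits.Ventures.CertifiedManyBodySolver.Upper.DWaveBoxPairWeightClosedForm
import HarnessLib

/-!
# The `d`-wave pair source of the open box as a sum over UNORDERED bonds: `P_C = √2 · Σ_{β = {p,q}} s_β b_β`

HONEST FRAMING: first certified bounds; not a superconductivity verdict. Nothing in this file is a number or a
row: it is the operator identity behind the FORMAT-mpsgf1 dictionary «κ := √2 · h_tree» (sr-mbsolver-var-10
SIZING-LINE / FORMAT-mpsgf1 §1): the tree's source `Σ_{(p,q)} w_C(p,q) b_{pq}` of
`dWaveSourceOpenBox a b U μ h = hamiltonianWith (rectBoxGraph a b) 1 U μ − h (P_C + P_Cᴴ)` runs over ORDERED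
pairs with the symmetric weight `w_C(p,q) = ±1/√2` on bonds (`dWaveBoxPairWeight_eq_closedForm`), and the singlet
pair operator is symmetric (`b_{qp} = b_{pq}` by the CAR), so every unordered bond `β = {p,q}` is counted twice:
`P_C = Σ_{p<q, p∼q} √2 · s_{pq} · b_{pq}`, `s_{pq} = +1` on x-bonds (first coordinates differ) and `−1` on y-bonds —
i.e. the producers' per-bond pair term with coupling `κ = √2 h`. Written by the IRD desk (sr-mbsolver-ird-5) as the
kernel form of the model audit its `mpsgf_audit` leg M performs numerically; seat hubbard-obs-pin-1's files are
untouched. No new definition is introduced (the sign is spelled as an `if`).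

* `bondPair_swap`: `b_{qp} = b_{pq}`;
* `sum_dWaveBoxPairWeight_smul_bondPair_eq_sum_lt`: the ordered-pair source equals the `p < q` bond sum with
  coefficient `√2 · s_{pq}`;
* `dWaveSourceOpenBox_eq_bondForm`: the sourced box rewritten with that bond sum.
-/

noncomputable section
namespace Summit.Ventures.CertifiedManyBodySolver
open Matrix Finset Literature.Probability.LatticeModels
open Literature.MathematicalPhysics.QuantumLattice Literature.Barriers.HubbardSuperconductivity HubbardWave0

section BondForm

variable {Λ : Type*} [LinearOrder Λ] [Fintype Λ]

/-- The singlet pair operator is symmetric in its two sites: `b_{qp} = c_{q↑}c_{p↓} − c_{q↓}c_{p↑} = b_{pq}`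
(two uses of `{c_i, c_j} = 0`). [cite: Scalapino1995, §2 eq. (2.2)–(2.3)] -/
theorem bondPair_swap (p q : Λ) : bondPair q p = bondPair p q := by
  unfold bondPair
  have h1 : annihilation (orb q 0) * annihilation (orb p 1) = -(annihilation (orb p 1) * annihilation (orb q 0)) :=
    eq_neg_of_add_eq_zero_left (annihilation_anticommute_holds _ _)
  have h2 : annihilation (orb q 1) * annihilation (orb p 0) = -(annihilation (orb p 0) * annihilation (orb q 1)) :=
    eq_neg_of_add_eq_zero_left (annihilation_anticommute_holds _ _)
  rw [h1, h2]; abel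

/-- **The ordered-pair source is the unordered-bond sum with coupling `√2`**:
`Σ_{(p,q)} w_C(p,q) b_{pq} = Σ_{(p,q) : p < q, p ∼ q} (√2 · s_{pq}) b_{pq}` — each bond of `rectBoxGraph a b`
once, `s_{pq} = +1` if the first coordinates differ (x-bond), `−1` otherwise (y-bond); hence
`−h(P_C + P_Cᴴ) = −(√2 h) Σ_β s_β (b_β + b_βᴴ)`, the producers' `κ = √2 h`. [cite: KomaTasaki1994, §1] -/
theorem sum_dWaveBoxPairWeight_smul_bondPair_eq_sum_lt (a b : ℕ) :
    (∑ z : (Fin a ×ₗ Fin b) × (Fin a ×ₗ Fin b), dWaveBoxPairWeight a b z • bondPair z.1 z.2) =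
      ∑ z : (Fin a ×ₗ Fin b) × (Fin a ×ₗ Fin b),
        (if z.1 < z.2 ∧ (rectBoxGraph a b).Adj z.1 z.2
          then (((Real.sqrt 2 * (if (ofLex z.1).1 ≠ (ofLex z.2).1 then (1 : ℝ) else -1) : ℝ)) : ℂ) else 0) •
          bondPair z.1 z.2 := by
  classical
  -- half-weight term on `p < q` bonds; every ordered-pair term splits as `f z + f z.swap`, the diagonal vanishes
  set f : (Fin a ×ₗ Fin b) × (Fin a ×ₗ Fin b) → Matrix (Finset (Orb (Fin a ×ₗ Fin b))) (Finset (Orb (Fin a ×ₗ Fin b))) ℂ :=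
    fun z => (if z.1 < z.2 ∧ (rectBoxGraph a b).Adj z.1 z.2
      then (((if (ofLex z.1).1 ≠ (ofLex z.2).1 then (1 : ℝ) else -1) / Real.sqrt 2 : ℝ) : ℂ) else 0) •
      bondPair z.1 z.2 with hf
  have hsplit : ∀ z : (Fin a ×ₗ Fin b) × (Fin a ×ₗ Fin b), dWaveBoxPairWeight a b z • bondPair z.1 z.2 = f z + f (z.2, z.1) := by
    intro z
    obtain ⟨p, q⟩ := z
    simp only [hf]
    rw [dWaveBoxPairWeight_eq_closedForm, bondPair_swap q p]
    rcases lt_trichotomy p q with hpq | rfl | hqp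
    · have : ¬ q < p := not_lt.2 hpq.le
      by_cases hA : (rectBoxGraph a b).Adj p q
      · simp [hpq, this, hA]
      · have hA' : ¬ (rectBoxGraph a b).Adj q p := fun h => hA h.symm
        simp [hA, hA']
    · simp [SimpleGraph.irrefl]
    · have : ¬ p < q := not_lt.2 hqp.le
      by_cases hA : (rectBoxGraph a b).Adj p q
      · have hA' : (rectBoxGraph a b).Adj q p := hA.symm
        simp [hqp, this, hA, hA', ne_comm]
      · have hA' : ¬ (rectBoxGraph a b).Adj q p := fun h => hA h.symm
        simp [hA, hA']
  -- the swapped copy has the same sum (reindex by `Equiv.prodComm`)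
  have hswap : (∑ z : (Fin a ×ₗ Fin b) × (Fin a ×ₗ Fin b), f (z.2, z.1)) = ∑ z : (Fin a ×ₗ Fin b) × (Fin a ×ₗ Fin b), f z :=
    Fintype.sum_equiv (Equiv.prodComm (Fin a ×ₗ Fin b) (Fin a ×ₗ Fin b)) _ _ (fun z => rfl)
  calc (∑ z : (Fin a ×ₗ Fin b) × (Fin a ×ₗ Fin b), dWaveBoxPairWeight a b z • bondPair z.1 z.2)
      = ∑ z : (Fin a ×ₗ Fin b) × (Fin a ×ₗ Fin b), (f z + f (z.2, z.1)) := Finset.sum_congr rfl fun z _ => hsplit z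
    _ = (∑ z : (Fin a ×ₗ Fin b) × (Fin a ×ₗ Fin b), f z) + ∑ z : (Fin a ×ₗ Fin b) × (Fin a ×ₗ Fin b), f (z.2, z.1) := Finset.sum_add_distrib
    _ = (∑ z : (Fin a ×ₗ Fin b) × (Fin a ×ₗ Fin b), f z) + ∑ z : (Fin a ×ₗ Fin b) × (Fin a ×ₗ Fin b), f z := by rw [hswap]
    _ = ∑ z : (Fin a ×ₗ Fin b) × (Fin a ×ₗ Fin b), (f z + f z) := Finset.sum_add_distrib.symm
    _ = _ := Finset.sum_congr rfl fun z _ => ?_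
  -- termwise: `f z + f z = (√2 s) • b` on bonds with `p < q`, `0` otherwise
  simp only [hf]
  by_cases h : z.1 < z.2 ∧ (rectBoxGraph a b).Adj z.1 z.2
  · rw [if_pos h, if_pos h, ← add_smul]
    congr 1
    rw [← Complex.ofReal_add, Complex.ofReal_inj]
    have hs : Real.sqrt 2 ≠ 0 := Real.sqrt_ne_zero'.2 (by norm_num)
    field_simp
    rw [Real.sq_sqrt (by norm_num : (0:ℝ) ≤ 2)]
    ring
  · rw [if_neg h, if_neg h, zero_smul, add_zero]

/-- **The open sourced box in bond form**: `dWaveSourceOpenBox a b U μ h = hamiltonianWith (rectBoxGraph a b) 1 U μ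
− h (Q + Qᴴ)` with `Q = Σ_{p<q, p∼q} (√2 s_{pq}) b_{pq}` — the grand-canonical Hubbard box minus `√2 h` times the signed
sum of singlet pair operators over the box bonds, each bond once (the object FORMAT-mpsgf1 producers evaluate with
`κ = √2 h`). [cite: KomaTasaki1994, §1] -/
theorem dWaveSourceOpenBox_eq_bondForm (a b : ℕ) (U μ h : ℝ) :
    dWaveSourceOpenBox a b U μ h =
      hamiltonianWith (rectBoxGraph a b) 1 U μ -
        (h : ℂ) • ((∑ z : (Fin a ×ₗ Fin b) × (Fin a ×ₗ Fin b),
            (if z.1 < z.2 ∧ (rectBoxGraph a b).Adj z.1 z.2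
              then (((Real.sqrt 2 * (if (ofLex z.1).1 ≠ (ofLex z.2).1 then (1 : ℝ) else -1) : ℝ)) : ℂ)
              else 0) • bondPair z.1 z.2) +
          (∑ z : (Fin a ×ₗ Fin b) × (Fin a ×ₗ Fin b),
            (if z.1 < z.2 ∧ (rectBoxGraph a b).Adj z.1 z.2
              then (((Real.sqrt 2 * (if (ofLex z.1).1 ≠ (ofLex z.2).1 then (1 : ℝ) else -1) : ℝ)) : ℂ)
              else 0) • bondPair z.1 z.2)ᴴ) := by
  unfold dWaveSourceOpenBox
  rw [sum_dWaveBoxPairWeight_smul_bondPair_eq_sum_lt]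

/-- **Zero field**: at `h = 0` the sourced box is the plain grand-canonical Hubbard box
`hamiltonianWith (rectBoxGraph a b) 1 U μ` — so a zero-field energy window of a sourced trial state (the two-field
node shape) is an ordinary variational statement about `H − μN` on the open box. [cite: KomaTasaki1994, §1] -/
theorem dWaveSourceOpenBox_zero_field (a b : ℕ) (U μ : ℝ) :
    dWaveSourceOpenBox a b U μ 0 = hamiltonianWith (rectBoxGraph a b) 1 U μ := by
  unfold dWaveSourceOpenBox
  rw [Complex.ofReal_zero, zero_smul, sub_zero]

/-- **The field enters linearly**: `A_C(μ, h) = A_C(μ, 0) − h·(P_C + P_Cᴴ)` with `P_C` the ordered-pair source —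
the affine-in-`h` structure behind reading one certified state at every field. [cite: KomaTasaki1994, §1] -/
theorem dWaveSourceOpenBox_eq_zero_field_sub (a b : ℕ) (U μ h : ℝ) :
    dWaveSourceOpenBox a b U μ h =
      dWaveSourceOpenBox a b U μ 0 -
        (h : ℂ) • ((∑ z : (Fin a ×ₗ Fin b) × (Fin a ×ₗ Fin b), dWaveBoxPairWeight a b z • bondPair z.1 z.2) +
          (∑ z : (Fin a ×ₗ Fin b) × (Fin a ×ₗ Fin b), dWaveBoxPairWeight a b z • bondPair z.1 z.2)ᴴ) := by
  rw [dWaveSourceOpenBox_zero_field]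
  rfl

/-- **Ordered pairs versus bonds counted once** (general bookkeeping behind «both orientations» sums): for any
`f` on ordered pairs of a linearly ordered finite type that vanishes on the diagonal,
`Σ_{(p,q)} f(p,q) = Σ_{(p,q) : p < q} (f(p,q) + f(q,p))`. This is the pattern used for the pair source above and
by every reader that regroups a producer's ordered hopping / pair term list «one term per unordered bond».
[folklore] -/
theorem sum_prod_eq_sum_lt_add_swap {M : Type*} [AddCommMonoid M] (f : Λ × Λ → M)
    (hdiag : ∀ p : Λ, f (p, p) = 0) :
    (∑ z : Λ × Λ, f z) = ∑ z : Λ × Λ, if z.1 < z.2 then f z + f (z.2, z.1) else 0 := by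
  classical
  -- `g` keeps the `p < q` half of `f`, `k` the `p < q` half of `f ∘ swap`; then `f z = g z + k z.swap`
  set g : Λ × Λ → M := fun z => if z.1 < z.2 then f z else 0 with hg
  set k : Λ × Λ → M := fun z => if z.1 < z.2 then f (z.2, z.1) else 0 with hk
  have hsplit : ∀ z : Λ × Λ, f z = g z + k (z.2, z.1) := by
    intro z
    obtain ⟨p, q⟩ := z
    simp only [hg, hk]
    rcases lt_trichotomy p q with hpq | rfl | hqp
    · simp [hpq, not_lt.2 hpq.le]
    · simp [hdiag]
    · simp [hqp, not_lt.2 hqp.le]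
  have hswap : (∑ z : Λ × Λ, k (z.2, z.1)) = ∑ z : Λ × Λ, k z :=
    Fintype.sum_equiv (Equiv.prodComm Λ Λ) _ _ (fun z => rfl)
  calc (∑ z : Λ × Λ, f z) = ∑ z : Λ × Λ, (g z + k (z.2, z.1)) := Finset.sum_congr rfl fun z _ => hsplit z
    _ = (∑ z : Λ × Λ, g z) + ∑ z : Λ × Λ, k (z.2, z.1) := Finset.sum_add_distrib
    _ = (∑ z : Λ × Λ, g z) + ∑ z : Λ × Λ, k z := by rw [hswap]
    _ = ∑ z : Λ × Λ, (g z + k z) := Finset.sum_add_distrib.symm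
    _ = _ := Finset.sum_congr rfl fun z _ => ?_
  simp only [hg, hk]
  by_cases h : z.1 < z.2
  · rw [if_pos h, if_pos h, if_pos h]
  · rw [if_neg h, if_neg h, if_neg h, add_zero]

/-- **The Hubbard hopping in bond form** (any finite graph): the tree's ordered-pair hopping sum
`Σ_x Σ_y Σ_σ 1[x ∼ y] c†_{xσ} c_{yσ}` (which «produces both a term and its Hermitian conjugate», `hamiltonian`)
equals the sum over bonds counted once, `Σ_{(x,y): x<y, x∼y} Σ_σ (c†_{xσ} c_{yσ} + c†_{yσ} c_{xσ})` — the form in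
which certificate formats list hopping terms (FORMAT-mps1 §5 V2 bond set, FORMAT-mpsgf1 §3). [cite: arXiv9311033, §2] -/
theorem hopping_sum_eq_sum_lt (G : SimpleGraph Λ) [DecidableRel G.Adj] :
    (∑ x : Λ, ∑ y : Λ, ∑ σ : Fin 2,
        if G.Adj x y then creation (orb x σ) * annihilation (orb y σ) else (0 : Matrix (Finset (Orb Λ)) (Finset (Orb Λ)) ℂ)) =
      ∑ z : Λ × Λ, if z.1 < z.2 ∧ G.Adj z.1 z.2 then
        ∑ σ : Fin 2, (creation (orb z.1 σ) * annihilation (orb z.2 σ) + creation (orb z.2 σ) * annihilation (orb z.1 σ))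
        else 0 := by
  classical
  rw [← Fintype.sum_prod_type']
  rw [sum_prod_eq_sum_lt_add_swap (fun z : Λ × Λ => ∑ σ : Fin 2,
        if G.Adj z.1 z.2 then creation (orb z.1 σ) * annihilation (orb z.2 σ) else (0 : Matrix (Finset (Orb Λ)) (Finset (Orb Λ)) ℂ))
      (fun p => by simp [SimpleGraph.irrefl])]
  refine Finset.sum_congr rfl fun z _ => ?_
  by_cases hlt : z.1 < z.2
  · by_cases hA : G.Adj z.1 z.2
    · have hA' : G.Adj z.2 z.1 := hA.symm
      simp only [hlt, hA, hA', and_self, if_true, ← Finset.sum_add_distrib]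
    · have hA' : ¬ G.Adj z.2 z.1 := fun h => hA h.symm
      simp [hlt, hA, hA']
  · simp [hlt]

/-- **The Hubbard Hamiltonian in bond form** (any finite graph): `H = −t Σ_{bonds {x,y} once} Σ_σ (c†_{xσ}c_{yσ} +
c†_{yσ}c_{xσ}) + U Σ_x n_{x↑}n_{x↓}` — the tree's `hamiltonian G t U` (ordered-pair hopping) rewritten with each bond once.
[cite: arXiv9311033, §2] -/
theorem hamiltonian_eq_bondForm (G : SimpleGraph Λ) [DecidableRel G.Adj] (t U : ℝ) :
    hamiltonian G t U =
      -(t : ℂ) • (∑ z : Λ × Λ, if z.1 < z.2 ∧ G.Adj z.1 z.2 then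
          ∑ σ : Fin 2, (creation (orb z.1 σ) * annihilation (orb z.2 σ) + creation (orb z.2 σ) * annihilation (orb z.1 σ))
          else 0) +
        (U : ℂ) • ∑ x : Λ, numberOp x 0 * numberOp x 1 := by
  unfold hamiltonian
  rw [hopping_sum_eq_sum_lt]

end BondForm

section Decomposition

variable (a b : ℕ)

/-- **The sourced open box, term by term**: `A_C(U, μ, h) = H_box(t = 1, U = 0) + U·Σ_x n_{x↑}n_{x↓} − μ·N − h·(P_C + P_Cᴴ)`
(pure nearest-neighbour hopping `hamiltonian (rectBoxGraph a b) 1 0`, on-site repulsion, chemical potential, pair source).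
This is the operator identity behind the readers' decomposition check «E = K₁ + U·docc − μ₀·N − κ·X» of a FORMAT-mpsgf1
certificate (K₁ = the NN hopping row, docc = Σ⟨n↑n↓⟩, κ·X = h·⟨P_C + P_Cᴴ⟩ with κ = √2 h). [cite: KomaTasaki1994, §1] -/
theorem dWaveSourceOpenBox_eq_hopping_add_onSite_sub (U μ h : ℝ) :
    dWaveSourceOpenBox a b U μ h =
      hamiltonian (rectBoxGraph a b) 1 0 + (U : ℂ) • (∑ x : Fin a ×ₗ Fin b, numberOp x 0 * numberOp x 1) -
        (μ : ℂ) • totalNumber -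
        (h : ℂ) • ((∑ z : (Fin a ×ₗ Fin b) × (Fin a ×ₗ Fin b), dWaveBoxPairWeight a b z • bondPair z.1 z.2) +
          (∑ z : (Fin a ×ₗ Fin b) × (Fin a ×ₗ Fin b), dWaveBoxPairWeight a b z • bondPair z.1 z.2)ᴴ) := by
  have hsplit : hamiltonian (rectBoxGraph a b) 1 U =
      hamiltonian (rectBoxGraph a b) 1 0 + (U : ℂ) • ∑ x : Fin a ×ₗ Fin b, numberOp x 0 * numberOp x 1 := by
    simp [hamiltonian]
  unfold dWaveSourceOpenBox
  rw [hamiltonianWith_eq, hsplit]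

/-- **The Rayleigh decomposition** of a sourced-box energy for ANY vector `ψ`:
`Re⟨ψ, A_C ψ⟩ = Re⟨ψ, H_box(1,0) ψ⟩ + U·Re⟨ψ, (Σ n↑n↓) ψ⟩ − μ·Re⟨ψ, N ψ⟩ − h·Re⟨ψ, (P_C + P_Cᴴ) ψ⟩` — i.e.
`E = K₁ + U·docc − μ·N − κ·X` on certified pieces (the check the interval readers perform by value).
[cite: KomaTasaki1994, §1] -/
theorem re_star_dotProduct_dWaveSourceOpenBox_mulVec_decomposition (U μ h : ℝ) (ψ : Fock (Orb (Fin a ×ₗ Fin b))) :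
    (star ψ ⬝ᵥ (dWaveSourceOpenBox a b U μ h *ᵥ ψ)).re =
      (star ψ ⬝ᵥ (hamiltonian (rectBoxGraph a b) 1 0 *ᵥ ψ)).re +
        U * (star ψ ⬝ᵥ ((∑ x : Fin a ×ₗ Fin b, numberOp x 0 * numberOp x 1) *ᵥ ψ)).re -
        μ * (star ψ ⬝ᵥ (totalNumber *ᵥ ψ)).re -
        h * (star ψ ⬝ᵥ (((∑ z : (Fin a ×ₗ Fin b) × (Fin a ×ₗ Fin b), dWaveBoxPairWeight a b z • bondPair z.1 z.2) +
          (∑ z : (Fin a ×ₗ Fin b) × (Fin a ×ₗ Fin b), dWaveBoxPairWeight a b z • bondPair z.1 z.2)ᴴ) *ᵥ ψ)).re := by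
  rw [dWaveSourceOpenBox_eq_hopping_add_onSite_sub a b U μ h]
  simp only [sub_mulVec, add_mulVec, smul_mulVec, dotProduct_sub, dotProduct_add, dotProduct_smul, smul_eq_mul,
    Complex.sub_re, Complex.add_re, Complex.re_ofReal_mul]

end Decomposition

end Summit.Ventures.CertifiedManyBodySolver
end
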